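import Summits.BirchSwinnertonDyer.Rank1Residual.SmallImageMu.TeichOrbitNonConstancyEdges
import Summits.BirchSwinnertonDyer.BirchSwinnertonDyer.Theses.PrintX9
import Summits.BirchSwinnertonDyer.BirchSwinnertonDyer.Theses.PrintX10b
import Literature.NumberTheory.EllipticCurves.PAdicLFunctionMuInvariantCertificateProofs
import Literature.NumberTheory.EllipticCurves.Rank1Residual.CyclotomicWindingSpan
import HarnessLib

/-!
# Routes PrintX9 / PrintX10b, `μ`-cruxes 19630 `AnalyticMuZeroX9` and 20682 `AnalyticMuZeroX10b`:
# the bridges AN-S1 / AN-S2 are theorems, so the cruxes ARE the finite modular-symbol statements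
# AN-1 (class X9) and its `p = 3` twin (class X10b) — in the kernel, image-free

Cell `bsd-print-x9` (D-0131 (2) print tier), seat p2 («`μ = 0` by congruence transport + two-engine
analytic `μ = 0` certificate»), gen 3. HONEST FRAMING: theorems only (no definition, no named fact, no
`sorry`); nothing is booked; the file is a helper of cruxes 19630 / 20682 (`--supports`), not a closer —
both cruxes stay OPEN class-wide (Greenberg's Conj. 1.11 on the analytic side at prime-to-`p` irreducible
image).

What is new (kernel): the Literature file `PAdicLFunctionMuInvariantCertificateProofs` (this seat, same
session) proves the two PAPER bridges of cell `bsd-f3-mu` (MuLambdaCarriers §4) — at every ODD good ordinary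
`p` with `E[p]` irreducible, `TeichOrbitNonConstantAt W p ↔ MuAnZeroAt W p` (Teichmüller-orbit sums of plus
symbols non-constant mod `p` at some level ⟺ a unit coefficient of `L_p(f, α_E)`; MTT (10.1)–(10.2) +
Greenberg–Vatsal §3 integrality + Newton inversion of the Riemann sums). Here that is read on the routes:

* `SmallImageMu.an_s1`, `SmallImageMu.an_s2` — the hypotheses `hS1`, `hS2` of
  `SmallImageMu/TeichOrbitNonConstancyEdges` (p. `5 ≤ p`), verbatim, as theorems;
* `SmallImageMu.teichOrbitNonConstancyOnClassX9_iff_analyticMuZeroOnClassX9` — **AN-1 ⟺ item 19630**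
  (`Rank1Residual.AnalyticMuZeroOnClassX9`) unconditionally, and
  `SmallImageMu.printX9_analyticMuZeroX9_iff_teichOrbitNonConstancyOnClassX9` — the same with the PrintX9
  route decl `Theses.PrintX9.AnalyticMuZeroX9` by name;
* `SmallImageMu.teichOrbitNonConstancyIrreducible_iff_forall_muAnZeroAt` — AN-1⁺ ⟺ «analytic `μ = 0` at every
  good ordinary `p ≥ 5` with `E[p]` irreducible» (Greenberg's Conj. 1.11, analytic side, `p ≥ 5`);
* `X10.printX10b_analyticMuZeroX10b_iff_forall_teichOrbitNonConstantAt` — crux 20682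
  (`Theses.PrintX10b.AnalyticMuZeroX10b`) ⟺ «every X10b pair `(W, 3)` has `TeichOrbitNonConstantAt W 3`»;
  at `p = 3` the Teichmüller orbit is `{±u}` and `[·]⁺` is even, so this is the measure→coefficient half
  of the `p = 3` collapse of line `theoremB-x10b` (`stub_collapseThree`), stated as
  `X10.muAnZeroAt_three_of_teichOrbitNonConstantAt`;
* `SmallImageMu.muAnZeroAt_of_teichOrbitSum_certificate` — PER PAIR: one exact difference of two
  Teichmüller-orbit sums of the newform of `E` at one level `pⁿ`, `n ≥ 1`, of `p`-adic valuation `≤ 0`,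
  gives `MuAnZeroAt W p` in the kernel (modulo Carayol's `N = N_E` to pin the newform) — the kernel form of
  the census's two-engine `μ = 0` certificates (790 X9 pairs, 313 X10b pairs).

beyond-print theorem: no (Mazur–Tate–Teitelbaum folklore made kernel). References:
[MazurTateTeitelbaum1986Invent] §I.10–I.13; [GreenbergVatsal2000] (2)–(3), Prop. 3.7; [GreenbergLNM1716]
Conj. 1.11; cell bsd-f3-mu MEMO-an §3–§4, §10.3, §12.1.
-/

-- the summit and its single problem are both named `BirchSwinnertonDyer` (registry layout D-0017)
set_option linter.dupNamespace false

noncomputable section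

open scoped Classical MatrixGroups ModularForm

open CongruenceSubgroup WeierstrassCurve Literature.NumberTheory.EllipticCurves
  Literature.NumberTheory.EllipticCurves.ModularForms
  Summit.BirchSwinnertonDyer.BirchSwinnertonDyer.Rank1Residual
open Literature.NumberTheory.EllipticCurves.Rank1Residual (TeichOrbitNonConstantAt MuAnZeroAt
  teichOrbitSum teichOrbitNonConstantAt_iff_of_isNewformOf)

namespace Summit.BirchSwinnertonDyer.Rank1Residual.SmallImageMu

/-! ### §1 The two bridges in the exact shape of `TeichOrbitNonConstancyEdges` -/

/-- **AN-S1 as a theorem** (the hypothesis `hS1` of `analyticMuZeroOnClassX9_of_teichOrbitNonConstancy`,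
verbatim): at `p ≥ 5` good ordinary with `E[p]` irreducible, `TeichOrbitNonConstantAt W p ⟹ MuAnZeroAt W p`.
[cite: MazurTateTeitelbaum1986Invent, §I.10–I.13] [cite: GreenbergVatsal2000, Prop. 3.7] -/
theorem an_s1 : ∀ (W : WeierstrassCurve ℚ) [W.IsElliptic] [W.IsGloballyMinimal] (p : ℕ) [Fact p.Prime],
    5 ≤ p → IsOrdinaryAt W p → W.HasIrreducibleModPGaloisRep p →
    TeichOrbitNonConstantAt W p → MuAnZeroAt W p :=
  fun _ _ _ _ _ hp hord hirr hT ↦ muAnZeroAt_of_teichOrbitNonConstantAt (by omega) hord hirr hT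

/-- **AN-S2 as a theorem** (the hypothesis `hS2` of
`teichOrbitNonConstancyOnClassX9_of_analyticMuZeroOnClassX9`, verbatim): at `p ≥ 5` good ordinary with
`E[p]` irreducible, `MuAnZeroAt W p ⟹ TeichOrbitNonConstantAt W p`.
[cite: MazurTateTeitelbaum1986Invent, §I.10–I.13] [cite: GreenbergVatsal2000, Prop. 3.7] -/
theorem an_s2 : ∀ (W : WeierstrassCurve ℚ) [W.IsElliptic] [W.IsGloballyMinimal] (p : ℕ) [Fact p.Prime],
    5 ≤ p → IsOrdinaryAt W p → W.HasIrreducibleModPGaloisRep p →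
    MuAnZeroAt W p → TeichOrbitNonConstantAt W p :=
  fun _ _ _ _ _ hp hord hirr hμ ↦ teichOrbitNonConstantAt_of_muAnZeroAt (by omega) hord hirr hμ

/-! ### §2 AN-1 ⟺ item 19630, and the PrintX9 crux by name -/

/-- **AN-1 ⟹ item 19630, UNCONDITIONALLY**: `TeichOrbitNonConstancyOnClassX9 → AnalyticMuZeroOnClassX9`
(the Edges file's bookkeeping with `hS1 := an_s1`). [cite: MazurTateTeitelbaum1986Invent, §I.10–I.13] -/
theorem analyticMuZeroOnClassX9_of_teichOrbitNonConstancyOnClassX9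
    (hA : TeichOrbitNonConstancyOnClassX9) : AnalyticMuZeroOnClassX9 :=
  analyticMuZeroOnClassX9_of_teichOrbitNonConstancy an_s1 hA

/-- **Item 19630 ⟹ AN-1, UNCONDITIONALLY** (`hS2 := an_s2`). [cite: MazurTateTeitelbaum1986Invent, §I.10–I.13] -/
theorem teichOrbitNonConstancyOnClassX9_of_analyticMuZeroOnClassX9'
    (hA : AnalyticMuZeroOnClassX9) : TeichOrbitNonConstancyOnClassX9 :=
  teichOrbitNonConstancyOnClassX9_of_analyticMuZeroOnClassX9 an_s2 hA

/-- **AN-1 ⟺ item 19630** (`Rank1Residual.AnalyticMuZeroOnClassX9`): the analytic `μ`-crux of class X9 IS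
the finite modular-symbol statement «at every X9 pair, two Teichmüller-orbit sums of plus symbols of the
newform differ mod `p` at some level» — in the kernel, no paper bridge left.
[cite: MazurTateTeitelbaum1986Invent, §I.10–I.13] [cite: GreenbergLNM1716, §1 Conj. 1.11] -/
theorem teichOrbitNonConstancyOnClassX9_iff_analyticMuZeroOnClassX9 :
    TeichOrbitNonConstancyOnClassX9 ↔ AnalyticMuZeroOnClassX9 :=
  ⟨analyticMuZeroOnClassX9_of_teichOrbitNonConstancyOnClassX9,
    teichOrbitNonConstancyOnClassX9_of_analyticMuZeroOnClassX9'⟩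

/-- **Crux 19630 of route PrintX9 by name**: `Theses.PrintX9.AnalyticMuZeroX9 ↔ TeichOrbitNonConstancyOnClassX9`
(the route decl is `Rank1Residual.AnalyticMuZeroOnClassX9` by definition).
[cite: MazurTateTeitelbaum1986Invent, §I.10–I.13] [cite: GreenbergLNM1716, §1 Conj. 1.11] -/
theorem printX9_analyticMuZeroX9_iff_teichOrbitNonConstancyOnClassX9 :
    Summit.BirchSwinnertonDyer.BirchSwinnertonDyer.Theses.PrintX9.AnalyticMuZeroX9 ↔
      TeichOrbitNonConstancyOnClassX9 :=
  teichOrbitNonConstancyOnClassX9_iff_analyticMuZeroOnClassX9.symm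

/-- **AN-1⁺ ⟺ Greenberg's analytic `μ = 0` at `p ≥ 5`**: `TeichOrbitNonConstancyIrreducible ↔` «for every
`E/ℚ` and every good ordinary `p ≥ 5` with `E[p]` irreducible, `μ^an(E,p) = 0` (`MuAnZeroAt W p`)».
[cite: GreenbergLNM1716, §1 Conj. 1.11] [cite: MazurTateTeitelbaum1986Invent, §I.10–I.13] -/
theorem teichOrbitNonConstancyIrreducible_iff_forall_muAnZeroAt :
    TeichOrbitNonConstancyIrreducible ↔
      ∀ (W : WeierstrassCurve ℚ) [W.IsElliptic] [W.IsGloballyMinimal] (p : ℕ) [Fact p.Prime],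
        5 ≤ p → IsOrdinaryAt W p → W.HasIrreducibleModPGaloisRep p → MuAnZeroAt W p :=
  ⟨fun h W _ _ p _ hp hord hirr ↦ an_s1 W p hp hord hirr (h W p hp hord hirr),
    fun h W _ _ p _ hp hord hirr ↦ an_s2 W p hp hord hirr (h W p hp hord hirr)⟩

/-! ### §3 Per pair: one exact orbit-sum difference certifies `μ^an(E,p) = 0` in the kernel -/

/-- **The kernel form of a two-engine `μ = 0` certificate.** `p` odd, `E = W` good ordinary at `p` with
`E[p]` irreducible, `f` the newform of `E` (Carayol `hlev` pins the level, so `f` is THE newform); if at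
some level `pⁿ`, `n ≥ 1`, two Teichmüller-orbit sums of plus symbols `S_f(p,n,a)`, `S_f(p,n,a′)` (`a, a′`
units; `Rank1Residual.teichOrbitSum`, exact rationals) differ by a rational of `p`-adic norm `≥ 1`, then
`MuAnZeroAt W p`. The census instruments supply exactly such a difference per pair (the displayed binder `h`).
[cite: MazurTateTeitelbaum1986Invent, §I.10 (10.1)–(10.2)] [cite: GreenbergVatsal2000, Prop. 3.7] -/
theorem muAnZeroAt_of_teichOrbitSum_certificate {W : WeierstrassCurve ℚ} [W.IsElliptic]
    [W.IsGloballyMinimal] {p : ℕ} [Fact p.Prime] (hp2 : p ≠ 2) (hord : IsOrdinaryAt W p)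
    (hirr : W.HasIrreducibleModPGaloisRep p)
    (hlev : ∀ (N : ℕ) [NeZero N], IsNewformOf.level_eq_conductorNorm (N := N))
    {N : ℕ} [NeZero N] {f : CuspForm (Gamma0 N) 2} (hf : IsNewformOf W f) {n : ℕ} (hn : 1 ≤ n)
    (a a' : (ZMod (p ^ n))ˣ)
    (h : 1 ≤ ‖((teichOrbitSum f p n (a : ZMod (p ^ n)) -
      teichOrbitSum f p n (a' : ZMod (p ^ n)) : ℚ) : ℚ_[p])‖) :
    MuAnZeroAt W p :=
  muAnZeroAt_of_teichOrbitNonConstantAt hp2 hord hirr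
    ((teichOrbitNonConstantAt_iff_of_isNewformOf hlev hf).mpr ⟨n, hn, a, a', h⟩)

/-- The same certificate read through `padicValRat`: a NON-ZERO rational difference `q` of two orbit sums
with `ord_p q ≤ 0` (e.g. `q ∈ ½ℤ ∖ pℤ_(p)`) certifies `MuAnZeroAt W p`.
[cite: MazurTateTeitelbaum1986Invent, §I.10 (10.1)–(10.2)] [cite: Koblitz1984, Ch. I §2 (p. 2: |x|_p = p^(-ord_p x))] -/
theorem muAnZeroAt_of_teichOrbitSum_certificate_padicValRat {W : WeierstrassCurve ℚ} [W.IsElliptic]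
    [W.IsGloballyMinimal] {p : ℕ} [Fact p.Prime] (hp2 : p ≠ 2) (hord : IsOrdinaryAt W p)
    (hirr : W.HasIrreducibleModPGaloisRep p)
    (hlev : ∀ (N : ℕ) [NeZero N], IsNewformOf.level_eq_conductorNorm (N := N))
    {N : ℕ} [NeZero N] {f : CuspForm (Gamma0 N) 2} (hf : IsNewformOf W f) {n : ℕ} (hn : 1 ≤ n)
    (a a' : (ZMod (p ^ n))ˣ) {q : ℚ}
    (hq : teichOrbitSum f p n (a : ZMod (p ^ n)) - teichOrbitSum f p n (a' : ZMod (p ^ n)) = q)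
    (hq0 : q ≠ 0) (hv : padicValRat p q ≤ 0) : MuAnZeroAt W p :=
  muAnZeroAt_of_teichOrbitSum_certificate hp2 hord hirr hlev hf hn a a'
    (by rw [hq]; exact (Rank1Residual.one_le_norm_ratCast_iff q).mpr ⟨hq0, hv⟩)

end Summit.BirchSwinnertonDyer.Rank1Residual.SmallImageMu

/-! ### §4 Class X10b (`p = 3`): crux 20682 ⟺ Teichmüller-orbit non-constancy at `3` on the class -/

namespace Summit.BirchSwinnertonDyer.Rank1Residual.X10

open Literature.NumberTheory.EllipticCurves.Rank1Residual

/-- **The `p = 3` bridge** (measure→coefficient half of the `p = 3` collapse of line `theoremB-x10b`,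
`stub_collapseThree`, in Teichmüller-orbit currency — at `p = 3` the orbit of `u` is `{±u}` and the plus
symbol is even, so `S_f(3,n,u) = 2·[u/3ⁿ]⁺_f`): for `E = W` good ordinary at `3` with `E[3]` irreducible,
`TeichOrbitNonConstantAt W 3 ⟹ MuAnZeroAt W 3`. [cite: MazurTateTeitelbaum1986Invent, §I.10–I.13]
[cite: GreenbergVatsal2000, Prop. 3.7] -/
theorem muAnZeroAt_three_of_teichOrbitNonConstantAt (W : WeierstrassCurve ℚ) [W.IsElliptic]
    [W.IsGloballyMinimal] (hord : IsOrdinaryAt W 3) (hirr : W.HasIrreducibleModPGaloisRep 3)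
    (hT : TeichOrbitNonConstantAt W 3) : MuAnZeroAt W 3 :=
  muAnZeroAt_of_teichOrbitNonConstantAt (by decide) hord hirr hT

/-- **Crux 20682 of route PrintX10b by name ⟺ orbit non-constancy at `3` on class X10b**:
`Theses.PrintX10b.AnalyticMuZeroX10b ↔ ∀ X10b pairs (W, p) (so p = 3), TeichOrbitNonConstantAt W p` —
the analytic `μ`-crux of the second leaf IS a finite modular-symbol statement per mod-`3` representation,
in the kernel (`teichOrbitNonConstantAt_iff_muAnZeroAt` at `p = 3`; `ClassX10 W p` supplies `p = 3`, good
ordinary, `E[3]` irreducible). [cite: MazurTateTeitelbaum1986Invent, §I.10–I.13] [cite: GreenbergLNM1716, §1 Conj. 1.11] -/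
theorem printX10b_analyticMuZeroX10b_iff_forall_teichOrbitNonConstantAt :
    Summit.BirchSwinnertonDyer.BirchSwinnertonDyer.Theses.PrintX10b.AnalyticMuZeroX10b ↔
      ∀ (W : WeierstrassCurve ℚ) [W.IsElliptic] [W.IsGloballyMinimal] (p : ℕ) [Fact p.Prime],
        ClassX10 W p → ¬ Surj W 3 → TeichOrbitNonConstantAt W p := by
  unfold Summit.BirchSwinnertonDyer.BirchSwinnertonDyer.Theses.PrintX10b.AnalyticMuZeroX10b
    AnalyticMuZeroOnClassX10b
  constructor
  · intro hA W _ _ p _ hX hns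
    obtain ⟨hp3, ⟨hgood, hord⟩, hirr, -⟩ := id hX
    subst hp3
    exact teichOrbitNonConstantAt_of_muAnZeroAt (by decide) ⟨hgood, hord⟩ hirr
      (fun f hf ↦ hA W 3 f hX hns hf)
  · intro hT W _ _ p _ N _ f hX hns hf
    obtain ⟨hp3, ⟨hgood, hord⟩, hirr, -⟩ := id hX
    subst hp3
    exact muAnZeroAt_of_teichOrbitNonConstantAt (by decide) ⟨hgood, hord⟩ hirr (hT W 3 hX hns) f hf

end Summit.BirchSwinnertonDyer.Rank1Residual.X10

end
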